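import Literature.NumberTheory.Automorphic.HilbertRepSpectrum
import Mathlib.Analysis.InnerProductSpace.l2Space
import Mathlib.Analysis.InnerProductSpace.Adjoint
import Mathlib.Analysis.Normed.Operator.Extend
import Mathlib.Algebra.Star.Prod
import HarnessLib

/-!
# Comparison of traces: a Hilbert–Schmidt inequality between two operator families forces an
intertwiner (Jacquet–Langlands, *Automorphic forms on `GL(2)`*, LNM 114 (1970), Lemma 16.1.1;
Gelbart, *Automorphic forms on adele groups* (1975), Lemma 10.6)

Topic `NumberTheory/Automorphic`; theorems only, sibling of `HilbertRepSpectrum`, `HilbertRepSchur`.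
This is the abstract functional-analytic lemma through which the comparison of the trace formulas
for `GL(2)` and for the multiplicative group of a quaternion algebra produces the Jacquet–Langlands
correspondence (Jacquet–Langlands (1970), §16, proof of Thm. 16.1; Gelbart (1975), §10, proof of
Thm. 10.5, where it is quoted as Lemma 10.6 without proof):

> **Lemma 16.1.1.** Let `π₁`, `π₂` be unitary representations of `G` (central character `η`),
> `B` an ample (dense, `*`-closed) subalgebra of `L¹(η)` with `π₁(f)`, `π₂(f)` Hilbert–Schmidt for
> all `f ∈ B`. (i) If `tr π₁(f) π₁(f)^* ≥ tr π₂(f) π₂(f)^*` for every `f ∈ B` then `π₂` is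
> equivalent to a subrepresentation of `π₁`. (ii) If equality holds, `π₂ ≃ π₁`.

Since `tr π(f) π(f)^* = ‖π(f)‖²_HS = Σ_i ‖π(f) e_i‖²` (any Hilbert basis `(e_i)`), the hypothesis
of (i) is the inequality of Hilbert–Schmidt norms `Σ_j ‖π₂(f) c_j‖² ≤ Σ_i ‖π₁(f) b_i‖² < ∞`. The
printed proof (op. cit. pp. 497–499) consists of a Zorn reduction, "a simple remark", and a final
estimate. This file PROVES the heart of it — the remark and the estimate — in a form that needs no
discrete decomposition, no irreducibility and no compactness, and from which (i) follows by the
printed Zorn/Schur bookkeeping: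

* `forall_snd_apply_eq_zero_of_hilbertSchmidt_bound` (**the "simple remark"**, p. 498). Data: a
  family of groups `G v` (`v : 𝔳`; one group is the case of a one-point index type, the family of
  the local groups `GL₂(K_v)`, `v ∉ S`, is the case of the application) with unitary
  representations `π₁ v` on `H₁` and representations `π₂ v` on `H₂`; a `ℂ`-subspace `B` of
  `𝓑(H₁) × 𝓑(H₂)` closed under products, adjoints and left multiplication by every
  `(π₁ v g, π₂ v g)` (the pairs `(π₁(f), π₂(f))`, `f` in an ample algebra of functions stable under
  left translation); every first component Hilbert–Schmidt; a closed subspace `σ ≤ H₂` stable under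
  the second components; `y ∈ σ` and `c > 0` with `c ‖f₂ y‖² ≤ ‖f₁‖²_HS` for all `(f₁, f₂) ∈ B`.
  If every bounded operator `H₁ → σ` intertwining all the `G v` and `B` vanishes, then `f₂ y = 0`
  for all `(f₁, f₂) ∈ B`. Proof as printed: the map `(f₁ b_i)_i ↦ f₂ y` is bounded on a subspace of
  the Hilbert sum `ℓ²(ι; H₁)` (Mathlib `lp`), extends to its closure (`LinearMap.extendOfNorm`),
  is composed with the orthogonal projection, intertwines because the closure and its orthogonal
  complement are stable under the diagonal operators `diag(π₁ g)`, `diag(h₁)` (whose adjoints are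
  `diag(π₁ g⁻¹)`, `diag(h₁^*)`), and its components along the coordinate embeddings
  `H₁ → ℓ²(ι; H₁)` are intertwiners `H₁ → σ`, hence zero; finitely supported vectors being dense
  (`lp.ext_continuousLinearMap`), the map is zero.
* `exists_intertwiner_of_hilbertSchmidt_le` (**Lemma 16.1.1 (i), core**; Gelbart's Lemma 10.6).
  Same `G`, `π₁`, `π₂`, `B`; assume the Hilbert–Schmidt inequality
  `Σ_j ‖f₂ c_j‖² ≤ Σ_i ‖f₁ b_i‖² < ∞` for all `(f₁, f₂) ∈ B`, and let `σ ≤ H₂` be closed, stable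
  under the `f₂`, and not killed by all of them. Then there is a **non-zero bounded operator
  `U : H₁ → H₂` with range in `σ` intertwining every `G v` (`U π₁(g) = π₂(g) U`) and `B`
  (`U f₁ = f₂ U`)**. Proof (the final estimate of op. cit. p. 499, with the eigenvector replaced by
  an arbitrary vector): for `x ∈ σ`, `(f'₁, f'₂) ∈ B` with `f'₂ x ≠ 0`, put `y = f'₂ x`; then
  `‖f₂ y‖² = ‖(f f')₂ x‖² ≤ ‖(f f')₂‖²_HS ‖x‖² ≤ ‖(f f')₁‖²_HS ‖x‖² ≤ ‖f₁‖²_HS ‖f'₁‖² ‖x‖²`, which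
  is the bound of the remark with `c = (‖f'₁‖² ‖x‖² + 1)⁻¹`; so if no intertwiner existed,
  `f'₂^* y = 0`, i.e. `‖f'₂ x‖² = ⟪f'₂^* f'₂ x, x⟫ = 0` — a contradiction.
* `exists_intertwiner_adjoint_of_hilbertSchmidt_le`, `exists_subspace_intertwiner_of_hilbertSchmidt_le`
  — the same conclusion read through the adjoint when `π₂` is unitary too: a bounded operator
  `H₂ → H₁` (resp. `σ → H₁` for a closed invariant subspace `σ`) intertwining `G` and `B` and
  non-zero on `σ`. This is the shape in which the lemma enters the proof of the Jacquet–Langlands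
  correspondence in the tree (`jacquetLanglands_transfer_surjective_of_intertwiner'`,
  `JacquetLanglandsSurjectiveOfIntertwinerGeneric`; `JacquetLanglandsExistsOfIntertwiner`): with
  `H₂ ⊇ σ` on the `GL(2)` side, `H₁` on the quaternion side and `B` the pairs `(τ'(f), τ(f))`, the
  trace identity `tr τ(f f^*) = tr τ'(f f^*)` (Gelbart (10.10)) yields the non-zero intertwiner
  from the cuspidal constituent into `L²` of the quaternion algebra.
* Hilbert–Schmidt toolkit (Mathlib has no Hilbert–Schmidt class; everything is stated with the sums
  `Σ_i ‖T b_i‖²` in `ℝ≥0∞` over a `HilbertBasis`): Parseval `Σ_i |⟪b_i, v⟫|² = ‖v‖²`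
  (`HilbertBasis.tsum_coe_nnnorm_inner_sq`); independence of the basis through
  `Σ_i ‖T b_i‖² = Σ_j ‖T^* c_j‖²` (`tsum_nnnorm_sq_apply_eq_tsum_nnnorm_sq_adjoint_apply`);
  `‖T v‖² ≤ ‖T‖²_HS ‖v‖²` (`nnnorm_apply_sq_le_tsum_nnnorm_sq_mul`);
  `‖S T‖²_HS ≤ ‖S‖²_HS ‖T‖²` (`tsum_nnnorm_sq_comp_apply_le`). Auxiliary: diagonal operators and
  their adjoints on `ℓ²(ι; H)` (`lp_two_exists_diagonal`, `lp_two_adjoint_diagonal`), the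
  extension-with-intertwining lemma `exists_extension_comp_eq_of_norm_le`, and
  `starProjection_apply_of_invariant` (a subspace stable under `A` and `A^*` reduces `A`).

Part of the inline (D-0026) decomposition of
`Literature.NumberTheory.Automorphic.jacquetLanglands_transfer_surjective` (Gelbart Thm. 10.5 (ii));
equally usable for `jacquetLanglands_transfer_exists` and `strong_multiplicity_one_quaternionUnits`.

## References

* H. Jacquet, R. P. Langlands, *Automorphic forms on `GL(2)`*, Lecture Notes in Math. 114,
  Springer (1970), §16, Lemma 16.1.1 and its proof, pp. 497–499 [JacquetLanglands1970].
* S. Gelbart, *Automorphic forms on adele groups*, Ann. of Math. Studies 83 (1975), Lemma 10.6,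
  (10.10), pp. 150–152 [Gelbart1975].
-/

noncomputable section

open scoped InnerProductSpace ENNReal NNReal ComplexConjugate lp
open Filter Topology

namespace Literature.NumberTheory.Automorphic

/-! ### Hilbert–Schmidt sums over a Hilbert basis -/

section HilbertSchmidt

variable {H H' H'' : Type*} [NormedAddCommGroup H] [InnerProductSpace ℂ H] [CompleteSpace H]
  [NormedAddCommGroup H'] [InnerProductSpace ℂ H'] [CompleteSpace H']
  [NormedAddCommGroup H''] [InnerProductSpace ℂ H''] [CompleteSpace H'']
  {ι ι' : Type*}

omit [CompleteSpace H] in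
/-- `‖⟪x, y⟫‖₊ = ‖⟪y, x⟫‖₊` (Mathlib `norm_inner_symm`). [folklore] -/
theorem coe_nnnorm_inner_symm (x y : H) : (‖⟪x, y⟫_ℂ‖₊ : ℝ≥0∞) = ‖⟪y, x⟫_ℂ‖₊ := by
  rw [← norm_toNNReal, norm_inner_symm, norm_toNNReal]

omit [CompleteSpace H] in
/-- **Parseval's identity** in `ℝ≥0∞`: `Σ_i |⟪b_i, v⟫|² = ‖v‖²` for a Hilbert basis `(b_i)`
(Mathlib `HilbertBasis.hasSum_inner_mul_inner`). [folklore] -/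
theorem HilbertBasis.tsum_coe_nnnorm_inner_sq (b : HilbertBasis ι ℂ H) (v : H) :
    ∑' i, (‖⟪b i, v⟫_ℂ‖₊ : ℝ≥0∞) ^ 2 = (‖v‖₊ : ℝ≥0∞) ^ 2 := by
  have h1 : HasSum (fun i => ‖⟪b i, v⟫_ℂ‖ ^ 2) (‖v‖ ^ 2) := by
    have h := (b.hasSum_inner_mul_inner v v).map RCLike.re RCLike.continuous_re
    rw [show (RCLike.re ⟪v, v⟫_ℂ : ℝ) = ‖v‖ ^ 2 from inner_self_eq_norm_sq v] at h
    convert h using 1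
    funext i
    simp only [Function.comp_apply]
    rw [← inner_conj_symm v (b i), RCLike.conj_mul, ← RCLike.ofReal_pow, RCLike.ofReal_re]
  have h2 : HasSum (fun i => ‖⟪b i, v⟫_ℂ‖₊ ^ 2) (‖v‖₊ ^ 2) := by
    rw [← NNReal.hasSum_coe]
    simpa only [NNReal.coe_pow, coe_nnnorm] using h1
  rw [← ENNReal.coe_pow, ← ENNReal.tsum_coe_eq h2]
  simp only [ENNReal.coe_pow]

/-- **The Hilbert–Schmidt sum does not depend on the basis, and equals that of the adjoint**:
`Σ_i ‖T b_i‖² = Σ_j ‖T^* c_j‖²` for Hilbert bases `(b_i)` of `H` and `(c_j)` of `H'`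
(both sides equal `Σ_{i,j} |⟪c_j, T b_i⟫|²` by Parseval). [folklore] -/
theorem tsum_nnnorm_sq_apply_eq_tsum_nnnorm_sq_adjoint_apply (b : HilbertBasis ι ℂ H)
    (c : HilbertBasis ι' ℂ H') (T : H →L[ℂ] H') :
    ∑' i, (‖T (b i)‖₊ : ℝ≥0∞) ^ 2 =
      ∑' j, (‖ContinuousLinearMap.adjoint T (c j)‖₊ : ℝ≥0∞) ^ 2 := by
  calc ∑' i, (‖T (b i)‖₊ : ℝ≥0∞) ^ 2
      = ∑' i, ∑' j, (‖⟪c j, T (b i)⟫_ℂ‖₊ : ℝ≥0∞) ^ 2 := by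
        refine tsum_congr fun i => ?_
        rw [HilbertBasis.tsum_coe_nnnorm_inner_sq]
    _ = ∑' j, ∑' i, (‖⟪c j, T (b i)⟫_ℂ‖₊ : ℝ≥0∞) ^ 2 := ENNReal.tsum_comm
    _ = ∑' j, ∑' i, (‖⟪b i, ContinuousLinearMap.adjoint T (c j)⟫_ℂ‖₊ : ℝ≥0∞) ^ 2 := by
        refine tsum_congr fun j => tsum_congr fun i => ?_
        rw [← ContinuousLinearMap.adjoint_inner_left, coe_nnnorm_inner_symm]
    _ = ∑' j, (‖ContinuousLinearMap.adjoint T (c j)‖₊ : ℝ≥0∞) ^ 2 := by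
        refine tsum_congr fun j => ?_
        rw [HilbertBasis.tsum_coe_nnnorm_inner_sq]

/-- **`‖T v‖² ≤ ‖T‖²_HS ‖v‖²`**: the operator norm is at most the Hilbert–Schmidt norm. [folklore] -/
theorem nnnorm_apply_sq_le_tsum_nnnorm_sq_mul (b : HilbertBasis ι ℂ H) (T : H →L[ℂ] H') (v : H) :
    (‖T v‖₊ : ℝ≥0∞) ^ 2 ≤ (∑' i, (‖T (b i)‖₊ : ℝ≥0∞) ^ 2) * (‖v‖₊ : ℝ≥0∞) ^ 2 := by
  obtain ⟨w, c, -⟩ := exists_hilbertBasis ℂ H'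
  rw [tsum_nnnorm_sq_apply_eq_tsum_nnnorm_sq_adjoint_apply b c T,
    ← HilbertBasis.tsum_coe_nnnorm_inner_sq c (T v), ← ENNReal.tsum_mul_right]
  refine ENNReal.tsum_le_tsum fun j => ?_
  rw [← ContinuousLinearMap.adjoint_inner_left, ← mul_pow]
  gcongr
  exact_mod_cast nnnorm_inner_le_nnnorm _ _

/-- **`‖S T‖²_HS ≤ ‖S‖²_HS ‖T‖²`**: `Σ_i ‖S (T b_i)‖² ≤ (Σ_j ‖S c_j‖²) ‖T‖²` for `T : H → H'`,
`S : H' → H''` (through the adjoints: `Σ_k ‖T^* S^* d_k‖² ≤ ‖T^*‖² Σ_k ‖S^* d_k‖²`). [folklore] -/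
theorem tsum_nnnorm_sq_comp_apply_le (b : HilbertBasis ι ℂ H) (c : HilbertBasis ι' ℂ H')
    (T : H →L[ℂ] H') (S : H' →L[ℂ] H'') :
    ∑' i, (‖(S ∘L T) (b i)‖₊ : ℝ≥0∞) ^ 2 ≤
      (∑' j, (‖S (c j)‖₊ : ℝ≥0∞) ^ 2) * (‖T‖₊ : ℝ≥0∞) ^ 2 := by
  obtain ⟨w, d, -⟩ := exists_hilbertBasis ℂ H''
  rw [tsum_nnnorm_sq_apply_eq_tsum_nnnorm_sq_adjoint_apply b d (S ∘L T),
    tsum_nnnorm_sq_apply_eq_tsum_nnnorm_sq_adjoint_apply c d S, ← ENNReal.tsum_mul_right]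
  refine ENNReal.tsum_le_tsum fun k => ?_
  rw [ContinuousLinearMap.adjoint_comp, ContinuousLinearMap.comp_apply, ← mul_pow]
  gcongr
  calc (‖ContinuousLinearMap.adjoint T (ContinuousLinearMap.adjoint S (d k))‖₊ : ℝ≥0∞)
      ≤ ‖ContinuousLinearMap.adjoint T‖₊ * ‖ContinuousLinearMap.adjoint S (d k)‖₊ := by
        exact_mod_cast (ContinuousLinearMap.adjoint T).le_opNNNorm _
    _ = ‖ContinuousLinearMap.adjoint S (d k)‖₊ * ‖T‖₊ := by
        rw [mul_comm, LinearIsometryEquiv.nnnorm_map]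

end HilbertSchmidt

/-! ### Reducing subspaces and extension of densely bounded maps -/

section Extension

variable {E F : Type*} [NormedAddCommGroup E] [InnerProductSpace ℂ E] [CompleteSpace E]
  [NormedAddCommGroup F] [NormedSpace ℂ F] [CompleteSpace F]

/-- A closed subspace `K` stable under `A` and under `A^*` reduces `A`: the orthogonal projection
onto `K` commutes with `A`. [folklore] -/
theorem starProjection_apply_of_invariant (K : Submodule ℂ E) [K.HasOrthogonalProjection]
    (A : E →L[ℂ] E) (hA : ∀ v ∈ K, A v ∈ K)
    (hA' : ∀ v ∈ K, ContinuousLinearMap.adjoint A v ∈ K) (v : E) :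
    K.starProjection (A v) = A (K.starProjection v) := by
  refine Submodule.eq_starProjection_of_mem_orthogonal' (hA _ (K.starProjection_apply_mem v))
    (z := A (v - K.starProjection v)) ?_ (by rw [← map_add, add_sub_cancel])
  rw [Submodule.mem_orthogonal]
  intro u hu
  rw [← ContinuousLinearMap.adjoint_inner_left]
  exact Submodule.inner_right_of_mem_orthogonal (hA' u hu) (K.sub_starProjection_mem_orthogonal v)

/-- **Extension with intertwining.** Let `L : X → E` (a Hilbert space) and `Φ : X → F` (a Banach
space) be linear with `‖Φ x‖ ≤ C ‖L x‖`. Then there is a bounded `Ψ : E → F` with `Ψ (L x) = Φ x`,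
with values in the closure of the range of `Φ`, and such that `Ψ A = A₂ Ψ` whenever `A` is a
bounded operator of `E` lifting a map `a` of `X` through `L` (`A (L x) = L (a x)`) that `Φ`
carries to `A₂` (`Φ (a x) = A₂ (Φ x)`) and whose adjoint preserves the closure of the range of `L`
(`Ψ` is the bounded extension of `L x ↦ Φ x` to the closure of the range, composed with the
orthogonal projection onto it). [folklore] -/
theorem exists_extension_comp_eq_of_norm_le {X : Type*} [AddCommGroup X] [Module ℂ X]
    (L : X →ₗ[ℂ] E) (Φ : X →ₗ[ℂ] F) (C : ℝ) (hC : ∀ x, ‖Φ x‖ ≤ C * ‖L x‖) :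
    ∃ Ψ : E →L[ℂ] F, (∀ x, Ψ (L x) = Φ x) ∧
      (∀ v, Ψ v ∈ closure (Set.range Φ)) ∧
      ∀ (A : E →L[ℂ] E) (A₂ : F →L[ℂ] F) (a : X → X), (∀ x, A (L x) = L (a x)) →
        (∀ x, Φ (a x) = A₂ (Φ x)) →
        (∀ v ∈ (LinearMap.range L).topologicalClosure,
          ContinuousLinearMap.adjoint A v ∈ (LinearMap.range L).topologicalClosure) →
        Ψ ∘L A = A₂ ∘L Ψ := by
  set V : Submodule ℂ E := (LinearMap.range L).topologicalClosure with hV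
  haveI : CompleteSpace V := (LinearMap.range L).isClosed_topologicalClosure.completeSpace_coe
  have hLV : ∀ x, L x ∈ V := fun x =>
    (LinearMap.range L).le_topologicalClosure (LinearMap.mem_range_self L x)
  set L' : X →ₗ[ℂ] V := LinearMap.codRestrict V L hLV with hL'
  have hL'coe : ∀ x, (L' x : E) = L x := fun x => rfl
  -- the range of `L'` is dense in `V`
  have hdense : DenseRange L' := by
    rw [DenseRange, Subtype.dense_iff, ← Set.range_comp]
    intro v hv
    have hfun : ((↑) : V → E) ∘ ⇑L' = ⇑L := funext hL'coe
    have h1 : v ∈ closure (Set.range ⇑L) := by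
      rw [← LinearMap.coe_range, ← Submodule.topologicalClosure_coe, ← hV]
      exact hv
    rwa [← hfun] at h1
  have hbound : ∃ C, ∀ x, ‖Φ x‖ ≤ C * ‖L' x‖ := ⟨C, fun x => by rw [Submodule.coe_norm]; exact hC x⟩
  set Φ' : V →L[ℂ] F := Φ.extendOfNorm L' with hΦ'
  have hΦ'L : ∀ x, Φ' (L' x) = Φ x := fun x => LinearMap.extendOfNorm_eq hdense hbound x
  set P := V.orthogonalProjectionOnto with hP
  refine ⟨Φ' ∘L P, fun x => ?_, fun v => ?_, fun A A₂ a h1 h2 h3 => ?_⟩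
  · -- `Ψ (L x) = Φ x`
    rw [ContinuousLinearMap.comp_apply]
    have : P (L x) = L' x := by
      rw [hP, ← hL'coe, Submodule.orthogonalProjectionOnto_mem_subspace_eq_self]
    rw [this, hΦ'L]
  · -- values in the closure of the range of `Φ`
    rw [ContinuousLinearMap.comp_apply]
    refine hdense.induction_on (p := fun w => Φ' w ∈ closure (Set.range Φ)) (P v)
      (isClosed_closure.preimage Φ'.continuous) fun x => ?_
    rw [hΦ'L]
    exact subset_closure (Set.mem_range_self x)
  · -- intertwining
    have hAV : ∀ v ∈ V, A v ∈ V := by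
      intro v hv
      have hv' : v ∈ closure (LinearMap.range L : Set E) := by
        rwa [← Submodule.topologicalClosure_coe]
      have : A v ∈ closure (LinearMap.range L : Set E) := by
        refine map_mem_closure A.continuous hv' fun w hw => ?_
        obtain ⟨x, rfl⟩ := LinearMap.mem_range.1 hw
        rw [SetLike.mem_coe, h1 x]
        exact LinearMap.mem_range_self L (a x)
      rwa [← SetLike.mem_coe, Submodule.topologicalClosure_coe]
    -- `A` restricted to `V`
    set AV : V →L[ℂ] V := (A ∘L V.subtypeL).codRestrict V (fun v => hAV v v.2) with hAVdef
    have hAVL : ∀ x, AV (L' x) = L' (a x) := fun x => by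
      apply Subtype.ext
      rw [hAVdef, ContinuousLinearMap.coe_codRestrict_apply, ContinuousLinearMap.comp_apply,
        Submodule.subtypeL_apply, hL'coe, hL'coe, h1]
    -- `Φ' ∘ AV = A₂ ∘ Φ'` on `V`, by density
    have hcomm : (fun w : V => Φ' (AV w)) = fun w => A₂ (Φ' w) := by
      refine hdense.equalizer (Φ'.continuous.comp AV.continuous) (A₂.continuous.comp Φ'.continuous)
        (funext fun x => ?_)
      simp only [Function.comp_apply]
      rw [hAVL, hΦ'L, hΦ'L, h2]
    -- the projection commutes with `A`
    have hPA : ∀ v, P (A v) = AV (P v) := fun v => by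
      apply Subtype.ext
      rw [hAVdef, ContinuousLinearMap.coe_codRestrict_apply, ContinuousLinearMap.comp_apply,
        Submodule.subtypeL_apply, hP, Submodule.coe_orthogonalProjectionOnto_apply,
        Submodule.coe_orthogonalProjectionOnto_apply]
      exact starProjection_apply_of_invariant V A hAV h3 v
    ext v
    rw [ContinuousLinearMap.comp_apply, ContinuousLinearMap.comp_apply, hPA,
      ContinuousLinearMap.comp_apply]
    exact congrFun hcomm (P v)

end Extension

/-! ### Diagonal operators on the Hilbert sum `ℓ²(ι; H)` -/

section Ell2

variable {H : Type*} [NormedAddCommGroup H] [InnerProductSpace ℂ H] [CompleteSpace H] {ι : Type*}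

omit [InnerProductSpace ℂ H] [CompleteSpace H] in
/-- `‖v‖² = Σ_i ‖v_i‖²` in `ℓ²(ι; H)` (Mathlib `lp.hasSum_norm`). [folklore] -/
theorem lp_two_hasSum_norm_sq (v : ℓ²(ι, H)) : HasSum (fun i => ‖v i‖ ^ 2) (‖v‖ ^ 2) := by
  have h := lp.hasSum_norm (by norm_num : 0 < (2 : ℝ≥0∞).toReal) v
  simp only [ENNReal.toReal_ofNat, Real.rpow_two] at h
  exact h

omit [InnerProductSpace ℂ H] [CompleteSpace H] in
/-- `‖v‖² = Σ_i ‖v_i‖²` in `ℓ²(ι; H)`, in `ℝ≥0∞`. [folklore] -/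
theorem lp_two_coe_nnnorm_sq (v : ℓ²(ι, H)) :
    (‖v‖₊ : ℝ≥0∞) ^ 2 = ∑' i, (‖v i‖₊ : ℝ≥0∞) ^ 2 := by
  have h : HasSum (fun i => ‖v i‖₊ ^ 2) (‖v‖₊ ^ 2) := by
    rw [← NNReal.hasSum_coe]
    simpa only [NNReal.coe_pow, coe_nnnorm] using lp_two_hasSum_norm_sq v
  rw [← ENNReal.coe_pow, ← ENNReal.tsum_coe_eq h]
  simp only [ENNReal.coe_pow]

omit [CompleteSpace H] in
/-- Bounded operators act coordinatewise on `ℓ²(ι; H)`: `Σ_i ‖A v_i‖² < ∞`. [folklore] -/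
theorem memℓp_two_apply (A : H →L[ℂ] H) (v : ℓ²(ι, H)) : Memℓp (fun i => A (v i)) 2 := by
  refine memℓp_gen ?_
  simp only [ENNReal.toReal_ofNat, Real.rpow_two]
  refine Summable.of_nonneg_of_le (fun i => sq_nonneg _) (fun i => ?_)
    ((lp_two_hasSum_norm_sq v).summable.mul_left (‖A‖ ^ 2))
  calc ‖A (v i)‖ ^ 2 ≤ (‖A‖ * ‖v i‖) ^ 2 := by
        gcongr
        exact A.le_opNorm _
    _ = ‖A‖ ^ 2 * ‖v i‖ ^ 2 := mul_pow _ _ _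

omit [CompleteSpace H] in
/-- **Diagonal operators on `ℓ²(ι; H)`**: a bounded operator `A` of `H` acts coordinatewise as a
bounded operator of the Hilbert sum (of norm `≤ ‖A‖`). [folklore] -/
theorem lp_two_exists_diagonal (A : H →L[ℂ] H) :
    ∃ D : ℓ²(ι, H) →L[ℂ] ℓ²(ι, H), ∀ (v : ℓ²(ι, H)) (i : ι), D v i = A (v i) := by
  let Dₗ : ℓ²(ι, H) →ₗ[ℂ] ℓ²(ι, H) :=
    { toFun := fun v => ⟨fun i => A (v i), memℓp_two_apply A v⟩
      map_add' := fun v w => by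
        ext i
        simp only [lp.coeFn_add, Pi.add_apply, map_add]
      map_smul' := fun c v => by
        ext i
        simp only [lp.coeFn_smul, Pi.smul_apply, map_smul, RingHom.id_apply] }
  refine ⟨Dₗ.mkContinuous ‖A‖ fun v => ?_, fun v i => rfl⟩
  have h1 : HasSum (fun i => ‖A (v i)‖ ^ 2) (‖Dₗ v‖ ^ 2) := lp_two_hasSum_norm_sq (Dₗ v)
  have h2 : HasSum (fun i => ‖A‖ ^ 2 * ‖v i‖ ^ 2) (‖A‖ ^ 2 * ‖v‖ ^ 2) :=
    (lp_two_hasSum_norm_sq v).mul_left _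
  have h3 : ‖Dₗ v‖ ^ 2 ≤ (‖A‖ * ‖v‖) ^ 2 := by
    rw [mul_pow]
    refine hasSum_le (fun i => ?_) h1 h2
    calc ‖A (v i)‖ ^ 2 ≤ (‖A‖ * ‖v i‖) ^ 2 := by
          gcongr
          exact A.le_opNorm _
      _ = ‖A‖ ^ 2 * ‖v i‖ ^ 2 := mul_pow _ _ _
  exact (sq_le_sq₀ (norm_nonneg _) (by positivity)).1 h3

/-- The adjoint of the diagonal operator of `A` is the diagonal operator of `A^*`. [folklore] -/
theorem lp_two_adjoint_diagonal {A : H →L[ℂ] H} {D D' : ℓ²(ι, H) →L[ℂ] ℓ²(ι, H)}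
    (hD : ∀ (v : ℓ²(ι, H)) (i : ι), D v i = A (v i))
    (hD' : ∀ (v : ℓ²(ι, H)) (i : ι), D' v i = ContinuousLinearMap.adjoint A (v i)) :
    ContinuousLinearMap.adjoint D = D' := by
  symm
  rw [ContinuousLinearMap.eq_adjoint_iff]
  intro v w
  rw [lp.inner_eq_tsum, lp.inner_eq_tsum]
  exact tsum_congr fun i => by rw [hD', hD, ContinuousLinearMap.adjoint_inner_left]

omit [CompleteSpace H] in
/-- The diagonal operator of `A` on a coordinate vector: `diag(A) (δ_i x) = δ_i (A x)`. [folklore] -/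
theorem lp_two_diagonal_single [DecidableEq ι] {A : H →L[ℂ] H} {D : ℓ²(ι, H) →L[ℂ] ℓ²(ι, H)}
    (hD : ∀ (v : ℓ²(ι, H)) (i : ι), D v i = A (v i)) (i : ι) (x : H) :
    D (lp.single (E := fun _ : ι => H) 2 i x) = lp.single (E := fun _ : ι => H) 2 i (A x) := by
  ext j
  rw [hD]
  by_cases hj : j = i
  · subst hj
    rw [lp.single_apply_self (E := fun _ : ι => H), lp.single_apply_self (E := fun _ : ι => H)]
  · rw [lp.single_apply_ne (E := fun _ : ι => H) 2 i x hj,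
      lp.single_apply_ne (E := fun _ : ι => H) 2 i (A x) hj, map_zero]

end Ell2

/-! ### Jacquet–Langlands, Lemma 16.1.1 -/

section Comparison

variable {𝔳 : Type*} {G : 𝔳 → Type*} [∀ v, Group (G v)]
  {H₁ : Type*} [NormedAddCommGroup H₁] [InnerProductSpace ℂ H₁] [CompleteSpace H₁]
  {H₂ : Type*} [NormedAddCommGroup H₂] [InnerProductSpace ℂ H₂] [CompleteSpace H₂]

/-- **Jacquet–Langlands' "simple remark"** (LNM 114, proof of Lemma 16.1.1, p. 498), abstract
Hilbert–Schmidt form. Let `(G v)_{v : 𝔳}` be a family of groups (a single group: one-point `𝔳`)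
with unitary representations `π₁ v` on `H₁` and representations `π₂ v` on `H₂`, and `B` a
subspace of `𝓑(H₁) × 𝓑(H₂)` closed under products, adjoints and left multiplication by every
`(π₁ v g, π₂ v g)`, all of whose first components are Hilbert–Schmidt (`Σ_i ‖f₁ b_i‖² < ∞`). Let
`σ ≤ H₂` be a closed subspace stable under the second components, `y ∈ σ`, and `c ≠ 0` with
`c ‖f₂ y‖² ≤ Σ_i ‖f₁ b_i‖²` for all `(f₁, f₂) ∈ B`. If every bounded operator `H₁ → H₂` with
values in `σ` intertwining all the `G v` and `B` is zero, then `f₂ y = 0` for every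
`(f₁, f₂) ∈ B`. [cite: JacquetLanglands1970, §16, Lemma 16.1.1 (proof, "a simple remark")] -/
theorem forall_snd_apply_eq_zero_of_hilbertSchmidt_bound
    (π₁ : ∀ v, ContRepresentation ℂ (G v) H₁) (π₂ : ∀ v, ContRepresentation ℂ (G v) H₂)
    (hπ₁ : ∀ v, (π₁ v).IsUnitary)
    (B : Submodule ℂ ((H₁ →L[ℂ] H₁) × (H₂ →L[ℂ] H₂)))
    (hmul : ∀ f ∈ B, ∀ h ∈ B, f * h ∈ B) (hstar : ∀ f ∈ B, star f ∈ B)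
    (hG : ∀ (v : 𝔳) (g : G v), ∀ f ∈ B,
      ((π₁ v g, π₂ v g) : (H₁ →L[ℂ] H₁) × (H₂ →L[ℂ] H₂)) * f ∈ B)
    {ι : Type*} (b : HilbertBasis ι ℂ H₁)
    (hfin : ∀ f ∈ B, ∑' i, (‖f.1 (b i)‖₊ : ℝ≥0∞) ^ 2 < ∞)
    (σ : Submodule ℂ H₂) (hσc : IsClosed (σ : Set H₂)) (hσB : ∀ f ∈ B, ∀ x ∈ σ, f.2 x ∈ σ)
    (hHom : ∀ U : H₁ →L[ℂ] H₂, (∀ v, U v ∈ σ) → (∀ (v : 𝔳) (g : G v), U ∘L π₁ v g = π₂ v g ∘L U) →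
      (∀ f ∈ B, U ∘L f.1 = f.2 ∘L U) → U = 0)
    {y : H₂} (hy : y ∈ σ) {c : ℝ≥0} (hc : c ≠ 0)
    (hbound : ∀ f ∈ B, (c : ℝ≥0∞) * (‖f.2 y‖₊ : ℝ≥0∞) ^ 2 ≤ ∑' i, (‖f.1 (b i)‖₊ : ℝ≥0∞) ^ 2) :
    ∀ f ∈ B, f.2 y = 0 := by
  classical
  -- the columns `(f₁ b_i)_i` are square summable
  have hsum : ∀ f : B, HasSum (fun i => ‖f.1.1 (b i)‖₊ ^ 2)
      (∑' i, ‖f.1.1 (b i)‖₊ ^ 2) := fun f => by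
    have hs : Summable fun i => ‖f.1.1 (b i)‖₊ ^ 2 := by
      rw [← ENNReal.tsum_coe_ne_top_iff_summable]
      simpa only [ENNReal.coe_pow] using (hfin f f.2).ne
    exact hs.hasSum
  have hmem : ∀ f : B, Memℓp (fun i => f.1.1 (b i)) 2 := fun f => by
    refine memℓp_gen ?_
    simp only [ENNReal.toReal_ofNat, Real.rpow_two]
    have := NNReal.summable_coe.2 (hsum f).summable
    simpa only [NNReal.coe_pow, coe_nnnorm] using this
  -- the column map `L : B → ℓ²(ι; H₁)`
  let L : B →ₗ[ℂ] ℓ²(ι, H₁) :=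
    { toFun := fun f => ⟨fun i => f.1.1 (b i), hmem f⟩
      map_add' := fun f h => by
        ext i
        simp only [Submodule.coe_add, Prod.fst_add, lp.coeFn_add, Pi.add_apply]
        rfl
      map_smul' := fun a f => by
        ext i
        simp only [Submodule.coe_smul, Prod.smul_fst, lp.coeFn_smul, Pi.smul_apply,
          RingHom.id_apply]
        rfl }
  have hL : ∀ (f : B) (i : ι), L f i = f.1.1 (b i) := fun _ _ => rfl
  have hLnorm : ∀ f : B, (‖L f‖₊ : ℝ≥0∞) ^ 2 = ∑' i, (‖f.1.1 (b i)‖₊ : ℝ≥0∞) ^ 2 :=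
    fun f => (lp_two_coe_nnnorm_sq (L f)).trans (tsum_congr fun i => rfl)
  -- the map `Φ : f ↦ f₂ y` and its bound
  let Φ : B →ₗ[ℂ] H₂ :=
    { toFun := fun f => f.1.2 y
      map_add' := fun f h => by simp only [Submodule.coe_add, Prod.snd_add, add_apply]
      map_smul' := fun a f => by
        simp only [Submodule.coe_smul, Prod.smul_snd, smul_apply, RingHom.id_apply] }
  have hΦ : ∀ f : B, Φ f = f.1.2 y := fun _ => rfl
  have hC : ∀ f : B, ‖Φ f‖ ≤ (NNReal.sqrt c : ℝ)⁻¹ * ‖L f‖ := fun f => by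
    have h1 : (c : ℝ≥0∞) * (‖Φ f‖₊ : ℝ≥0∞) ^ 2 ≤ (‖L f‖₊ : ℝ≥0∞) ^ 2 := by
      rw [hLnorm, hΦ]
      exact hbound f f.2
    have h2 : c * ‖Φ f‖₊ ^ 2 ≤ ‖L f‖₊ ^ 2 := by exact_mod_cast h1
    have h3 : NNReal.sqrt c * ‖Φ f‖₊ ≤ ‖L f‖₊ := by
      rw [← NNReal.sqrt_le_sqrt, NNReal.sqrt_mul, NNReal.sqrt_sq, NNReal.sqrt_sq] at h2
      exact h2
    have hc' : 0 < NNReal.sqrt c := NNReal.sqrt_pos.2 (pos_iff_ne_zero.2 hc)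
    have h4 : ‖Φ f‖₊ ≤ (NNReal.sqrt c)⁻¹ * ‖L f‖₊ := by
      rw [le_inv_mul_iff₀ hc']
      exact h3
    exact_mod_cast h4
  obtain ⟨Ψ, hΨL, hΨrange, hΨcomm⟩ := exists_extension_comp_eq_of_norm_le L Φ _ hC
  -- operators lifting maps of `B` through `L` preserve the closure of its range
  have hpres : ∀ (A : ℓ²(ι, H₁) →L[ℂ] ℓ²(ι, H₁)) (a : B → B), (∀ f, A (L f) = L (a f)) →
      ∀ v ∈ (LinearMap.range L).topologicalClosure,
        A v ∈ (LinearMap.range L).topologicalClosure := by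
    intro A a ha v hv
    have hv' : v ∈ closure (LinearMap.range L : Set (ℓ²(ι, H₁))) := by
      rwa [← Submodule.topologicalClosure_coe]
    have : A v ∈ closure (LinearMap.range L : Set (ℓ²(ι, H₁))) := by
      refine map_mem_closure A.continuous hv' fun w hw => ?_
      obtain ⟨x, rfl⟩ := LinearMap.mem_range.1 hw
      rw [SetLike.mem_coe, ha x]
      exact LinearMap.mem_range_self L (a x)
    rwa [← SetLike.mem_coe, Submodule.topologicalClosure_coe]
  -- `Ψ` intertwines the diagonal action of `G` with `π₂`
  have hΨG : ∀ (ν : 𝔳) (g : G ν) (D : ℓ²(ι, H₁) →L[ℂ] ℓ²(ι, H₁)),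
      (∀ v i, D v i = π₁ ν g (v i)) → Ψ ∘L D = π₂ ν g ∘L Ψ := by
    intro ν g D hD
    obtain ⟨D', hD'⟩ := lp_two_exists_diagonal (ι := ι) (π₁ ν g⁻¹)
    let a : B → B :=
      fun f => ⟨((π₁ ν g, π₂ ν g) : (H₁ →L[ℂ] H₁) × (H₂ →L[ℂ] H₂)) * f, hG ν g f f.2⟩
    let a' : B → B :=
      fun f => ⟨((π₁ ν g⁻¹, π₂ ν g⁻¹) : (H₁ →L[ℂ] H₁) × (H₂ →L[ℂ] H₂)) * f, hG ν g⁻¹ f f.2⟩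
    have ha : ∀ f, D (L f) = L (a f) := fun f => by
      ext i
      rw [hD, hL, hL]
      simp only [a, Prod.fst_mul, ContinuousLinearMap.mul_def, ContinuousLinearMap.comp_apply]
    have ha' : ∀ f, D' (L f) = L (a' f) := fun f => by
      ext i
      rw [hD', hL, hL]
      simp only [a', Prod.fst_mul, ContinuousLinearMap.mul_def, ContinuousLinearMap.comp_apply]
    refine hΨcomm D (π₂ ν g) a ha (fun f => ?_) ?_
    · rw [hΦ, hΦ]
      simp only [a, Prod.snd_mul, ContinuousLinearMap.mul_def, ContinuousLinearMap.comp_apply]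
    · have hadj : ContinuousLinearMap.adjoint D = D' :=
        lp_two_adjoint_diagonal hD (fun v i => by rw [hD', (hπ₁ ν).adjoint_apply])
      rw [hadj]
      exact hpres D' a' ha'
  -- `Ψ` intertwines the diagonal action of `B` with the second components
  have hΨB : ∀ h ∈ B, ∀ (D : ℓ²(ι, H₁) →L[ℂ] ℓ²(ι, H₁)), (∀ v i, D v i = h.1 (v i)) →
      Ψ ∘L D = h.2 ∘L Ψ := by
    intro h hh D hD
    obtain ⟨D', hD'⟩ := lp_two_exists_diagonal (ι := ι) (star h).1
    let a : B → B := fun f => ⟨h * f, hmul h hh f f.2⟩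
    let a' : B → B := fun f => ⟨star h * f, hmul _ (hstar h hh) f f.2⟩
    have ha : ∀ f, D (L f) = L (a f) := fun f => by
      ext i
      rw [hD, hL, hL]
      simp only [a, Prod.fst_mul, ContinuousLinearMap.mul_def, ContinuousLinearMap.comp_apply]
    have ha' : ∀ f, D' (L f) = L (a' f) := fun f => by
      ext i
      rw [hD', hL, hL]
      simp only [a', Prod.fst_mul, ContinuousLinearMap.mul_def, ContinuousLinearMap.comp_apply]
    refine hΨcomm D h.2 a ha (fun f => ?_) ?_
    · rw [hΦ, hΦ]
      simp only [a, Prod.snd_mul, ContinuousLinearMap.mul_def, ContinuousLinearMap.comp_apply]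
    · have hadj : ContinuousLinearMap.adjoint D = D' :=
        lp_two_adjoint_diagonal hD (fun v i => by
          rw [hD', Prod.fst_star, ContinuousLinearMap.star_eq_adjoint])
      rw [hadj]
      exact hpres D' a' ha'
  -- the values of `Ψ` lie in `σ`
  have hΨσ : ∀ v, Ψ v ∈ σ := fun v => by
    have hsub : closure (Set.range Φ) ⊆ σ := by
      refine closure_minimal ?_ hσc
      rintro _ ⟨f, rfl⟩
      exact hσB _ f.2 _ hy
    exact hsub (hΨrange v)
  -- the components of `Ψ` are intertwiners `H₁ → σ`, hence vanish
  have hcomp : ∀ i : ι, Ψ ∘L lp.singleContinuousLinearMap ℂ (fun _ : ι => H₁) 2 i = 0 := by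
    intro i
    refine hHom _ (fun v => hΨσ _) (fun ν g => ?_) (fun h hh => ?_)
    · obtain ⟨D, hD⟩ := lp_two_exists_diagonal (ι := ι) (π₁ ν g)
      ext v
      simp only [ContinuousLinearMap.comp_apply, lp.singleContinuousLinearMap_apply]
      rw [← lp_two_diagonal_single hD i v, ← ContinuousLinearMap.comp_apply (f := D), hΨG ν g D hD,
        ContinuousLinearMap.comp_apply]
    · obtain ⟨D, hD⟩ := lp_two_exists_diagonal (ι := ι) h.1
      ext v
      simp only [ContinuousLinearMap.comp_apply, lp.singleContinuousLinearMap_apply]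
      rw [← lp_two_diagonal_single hD i v, ← ContinuousLinearMap.comp_apply (f := D), hΨB h hh D hD,
        ContinuousLinearMap.comp_apply]
  -- hence `Ψ = 0` and `f₂ y = Ψ (L f) = 0`
  have hΨ0 : Ψ = 0 := by
    refine lp.ext_continuousLinearMap ENNReal.ofNat_ne_top fun i => ?_
    rw [hcomp i, ContinuousLinearMap.zero_comp]
  intro f hf
  have := hΨL ⟨f, hf⟩
  rw [hΨ0, hΦ] at this
  exact this.symm.trans (zero_apply _)

/-- **Jacquet–Langlands, Lemma 16.1.1 (i) (core); Gelbart, Lemma 10.6.** Let `(G v)_{v : 𝔳}`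
be a family of groups (a single group: one-point `𝔳`) with unitary representations `π₁ v` on
`H₁` and representations `π₂ v` on `H₂`, and `B ≤ 𝓑(H₁) × 𝓑(H₂)` a `ℂ`-subspace closed under
products, adjoints and left multiplication by every `(π₁ v g, π₂ v g)` — the pairs
`(π₁(f), π₂(f))` for `f` in an ample algebra. Assume the Hilbert–Schmidt inequality
`tr π₂(f) π₂(f)^* ≤ tr π₁(f) π₁(f)^* < ∞`, i.e. `Σ_j ‖f₂ c_j‖² ≤ Σ_i ‖f₁ b_i‖² < ∞` for all
`(f₁, f₂) ∈ B` and Hilbert bases `(b_i)`, `(c_j)`. Then for every closed subspace `σ ≤ H₂` stable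
under the `f₂` and on which some `f₂` is non-zero there is a **non-zero bounded operator
`U : H₁ → H₂` with values in `σ`, intertwining every `G v` (`U π₁(g) = π₂(g) U`) and `B`
(`U f₁ = f₂ U`)**. (For irreducible `σ` this is the step "`π₂^{β₀}` is equivalent to some
`π₁^α`" of the printed proof; (i) follows by Zorn's lemma as printed.)
[cite: JacquetLanglands1970, §16, Lemma 16.1.1] -/
theorem exists_intertwiner_of_hilbertSchmidt_le
    (π₁ : ∀ v, ContRepresentation ℂ (G v) H₁) (π₂ : ∀ v, ContRepresentation ℂ (G v) H₂)
    (hπ₁ : ∀ v, (π₁ v).IsUnitary)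
    (B : Submodule ℂ ((H₁ →L[ℂ] H₁) × (H₂ →L[ℂ] H₂)))
    (hmul : ∀ f ∈ B, ∀ h ∈ B, f * h ∈ B) (hstar : ∀ f ∈ B, star f ∈ B)
    (hG : ∀ (v : 𝔳) (g : G v), ∀ f ∈ B,
      ((π₁ v g, π₂ v g) : (H₁ →L[ℂ] H₁) × (H₂ →L[ℂ] H₂)) * f ∈ B)
    {ι : Type*} (b : HilbertBasis ι ℂ H₁) {κ : Type*} (c : HilbertBasis κ ℂ H₂)
    (hHS : ∀ f ∈ B, ∑' j, (‖f.2 (c j)‖₊ : ℝ≥0∞) ^ 2 ≤ ∑' i, (‖f.1 (b i)‖₊ : ℝ≥0∞) ^ 2)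
    (hfin : ∀ f ∈ B, ∑' i, (‖f.1 (b i)‖₊ : ℝ≥0∞) ^ 2 < ∞)
    (σ : Submodule ℂ H₂) (hσc : IsClosed (σ : Set H₂)) (hσB : ∀ f ∈ B, ∀ x ∈ σ, f.2 x ∈ σ)
    (hnd : ∃ f ∈ B, ∃ x ∈ σ, f.2 x ≠ 0) :
    ∃ U : H₁ →L[ℂ] H₂, U ≠ 0 ∧ (∀ v, U v ∈ σ) ∧ (∀ (v : 𝔳) (g : G v), U ∘L π₁ v g = π₂ v g ∘L U) ∧
      ∀ f ∈ B, U ∘L f.1 = f.2 ∘L U := by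
  by_contra hcon
  have hHom : ∀ U : H₁ →L[ℂ] H₂, (∀ v, U v ∈ σ) → (∀ (v : 𝔳) (g : G v), U ∘L π₁ v g = π₂ v g ∘L U) →
      (∀ f ∈ B, U ∘L f.1 = f.2 ∘L U) → U = 0 := by
    intro U h1 h2 h3
    by_contra hU
    exact hcon ⟨U, hU, h1, h2, h3⟩
  obtain ⟨f', hf', x, hx, hfx⟩ := hnd
  have hy : f'.2 x ∈ σ := hσB f' hf' x hx
  set c₀ : ℝ≥0 := (‖f'.1‖₊ ^ 2 * ‖x‖₊ ^ 2 + 1)⁻¹ with hc₀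
  have hc₀0 : c₀ ≠ 0 := inv_ne_zero (ne_of_gt (add_pos_of_nonneg_of_pos zero_le one_pos))
  have hc₀le : (c₀ : ℝ≥0∞) * ((‖f'.1‖₊ : ℝ≥0∞) ^ 2 * (‖x‖₊ : ℝ≥0∞) ^ 2) ≤ 1 := by
    have h : c₀ * (‖f'.1‖₊ ^ 2 * ‖x‖₊ ^ 2) ≤ 1 := by
      rw [hc₀, inv_mul_le_iff₀ (add_pos_of_nonneg_of_pos zero_le one_pos), mul_one]
      exact le_add_of_nonneg_right zero_le
    exact_mod_cast h
  have hbound : ∀ f ∈ B, (c₀ : ℝ≥0∞) * (‖f.2 (f'.2 x)‖₊ : ℝ≥0∞) ^ 2 ≤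
      ∑' i, (‖f.1 (b i)‖₊ : ℝ≥0∞) ^ 2 := by
    intro f hf
    have hff' : f * f' ∈ B := hmul f hf f' hf'
    calc (c₀ : ℝ≥0∞) * (‖f.2 (f'.2 x)‖₊ : ℝ≥0∞) ^ 2
        = c₀ * (‖(f * f').2 x‖₊ : ℝ≥0∞) ^ 2 := by
          rw [Prod.snd_mul, ContinuousLinearMap.mul_def, ContinuousLinearMap.comp_apply]
      _ ≤ c₀ * ((∑' j, (‖(f * f').2 (c j)‖₊ : ℝ≥0∞) ^ 2) * (‖x‖₊ : ℝ≥0∞) ^ 2) := by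
          gcongr
          exact nnnorm_apply_sq_le_tsum_nnnorm_sq_mul c _ x
      _ ≤ c₀ * ((∑' i, (‖(f * f').1 (b i)‖₊ : ℝ≥0∞) ^ 2) * (‖x‖₊ : ℝ≥0∞) ^ 2) := by
          gcongr
          exact hHS _ hff'
      _ ≤ c₀ * (((∑' i, (‖f.1 (b i)‖₊ : ℝ≥0∞) ^ 2) * (‖f'.1‖₊ : ℝ≥0∞) ^ 2) *
            (‖x‖₊ : ℝ≥0∞) ^ 2) := by
          gcongr
          rw [Prod.fst_mul, ContinuousLinearMap.mul_def]
          exact tsum_nnnorm_sq_comp_apply_le b b f'.1 f.1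
      _ = (c₀ * ((‖f'.1‖₊ : ℝ≥0∞) ^ 2 * (‖x‖₊ : ℝ≥0∞) ^ 2)) *
            ∑' i, (‖f.1 (b i)‖₊ : ℝ≥0∞) ^ 2 := by ring
      _ ≤ 1 * ∑' i, (‖f.1 (b i)‖₊ : ℝ≥0∞) ^ 2 := by
          gcongr
      _ = ∑' i, (‖f.1 (b i)‖₊ : ℝ≥0∞) ^ 2 := one_mul _
  have hzero := forall_snd_apply_eq_zero_of_hilbertSchmidt_bound π₁ π₂ hπ₁ B hmul hstar hG b hfin
    σ hσc hσB hHom hy hc₀0 hbound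
  have h1 : (star f').2 (f'.2 x) = 0 := hzero _ (hstar f' hf')
  rw [Prod.snd_star, ContinuousLinearMap.star_eq_adjoint] at h1
  apply hfx
  have : ⟪f'.2 x, f'.2 x⟫_ℂ = 0 := by
    rw [← ContinuousLinearMap.adjoint_inner_left, h1, inner_zero_left]
  exact inner_self_eq_zero.1 this

/-- **Lemma 16.1.1, adjoint form.** Under the hypotheses of
`exists_intertwiner_of_hilbertSchmidt_le` with the `π₂ v` unitary as well, there is a bounded
operator `S : H₂ → H₁` intertwining every `G v` (`S π₂(g) = π₁(g) S`) and `B` (`S f₂ = f₁ S`)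
which does **not** vanish on `σ` (`S = U^*` for the `U` of that theorem: `‖U v‖² = ⟪v, U^* U v⟫`
and `U v ∈ σ`).
[cite: JacquetLanglands1970, §16, Lemma 16.1.1] -/
theorem exists_intertwiner_adjoint_of_hilbertSchmidt_le
    (π₁ : ∀ v, ContRepresentation ℂ (G v) H₁) (π₂ : ∀ v, ContRepresentation ℂ (G v) H₂)
    (hπ₁ : ∀ v, (π₁ v).IsUnitary) (hπ₂ : ∀ v, (π₂ v).IsUnitary)
    (B : Submodule ℂ ((H₁ →L[ℂ] H₁) × (H₂ →L[ℂ] H₂)))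
    (hmul : ∀ f ∈ B, ∀ h ∈ B, f * h ∈ B) (hstar : ∀ f ∈ B, star f ∈ B)
    (hG : ∀ (v : 𝔳) (g : G v), ∀ f ∈ B,
      ((π₁ v g, π₂ v g) : (H₁ →L[ℂ] H₁) × (H₂ →L[ℂ] H₂)) * f ∈ B)
    {ι : Type*} (b : HilbertBasis ι ℂ H₁) {κ : Type*} (c : HilbertBasis κ ℂ H₂)
    (hHS : ∀ f ∈ B, ∑' j, (‖f.2 (c j)‖₊ : ℝ≥0∞) ^ 2 ≤ ∑' i, (‖f.1 (b i)‖₊ : ℝ≥0∞) ^ 2)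
    (hfin : ∀ f ∈ B, ∑' i, (‖f.1 (b i)‖₊ : ℝ≥0∞) ^ 2 < ∞)
    (σ : Submodule ℂ H₂) (hσc : IsClosed (σ : Set H₂)) (hσB : ∀ f ∈ B, ∀ x ∈ σ, f.2 x ∈ σ)
    (hnd : ∃ f ∈ B, ∃ x ∈ σ, f.2 x ≠ 0) :
    ∃ S : H₂ →L[ℂ] H₁, (∃ x ∈ σ, S x ≠ 0) ∧ (∀ (v : 𝔳) (g : G v), S ∘L π₂ v g = π₁ v g ∘L S) ∧
      ∀ f ∈ B, S ∘L f.2 = f.1 ∘L S := by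
  obtain ⟨U, hU0, hUσ, hUG, hUB⟩ := exists_intertwiner_of_hilbertSchmidt_le π₁ π₂ hπ₁ B hmul
    hstar hG b c hHS hfin σ hσc hσB hnd
  refine ⟨ContinuousLinearMap.adjoint U, ?_, fun ν g => ?_, fun f hf => ?_⟩
  · by_contra! hS
    apply hU0
    ext v
    have h : ⟪U v, U v⟫_ℂ = 0 := by
      rw [← ContinuousLinearMap.adjoint_inner_right, hS _ (hUσ v), inner_zero_right]
    rw [zero_apply]
    exact inner_self_eq_zero.1 h
  · -- `U π₁(g⁻¹) = π₂(g⁻¹) U`, and take adjoints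
    have h := congrArg ContinuousLinearMap.adjoint (hUG ν g⁻¹)
    rw [ContinuousLinearMap.adjoint_comp, ContinuousLinearMap.adjoint_comp, (hπ₁ ν).adjoint_apply,
      (hπ₂ ν).adjoint_apply, inv_inv] at h
    exact h.symm
  · have h := congrArg ContinuousLinearMap.adjoint (hUB (star f) (hstar f hf))
    rw [ContinuousLinearMap.adjoint_comp, ContinuousLinearMap.adjoint_comp, Prod.fst_star,
      Prod.snd_star, ContinuousLinearMap.star_eq_adjoint, ContinuousLinearMap.star_eq_adjoint,
      ContinuousLinearMap.adjoint_adjoint, ContinuousLinearMap.adjoint_adjoint] at h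
    exact h.symm

/-- **Lemma 16.1.1 for a closed invariant subspace.** Same hypotheses, with `σ ≤ H₂` a closed
subspace invariant under every `π₂ v g`, stable under the `f₂` and not killed by all of them: there
is a **non-zero bounded operator `T : σ → H₁` intertwining the subrepresentation `σ` of the `π₂ v`
with the `π₁ v`** and the second components with the first. In the proof of the Jacquet–Langlands
correspondence (Gelbart (1975), p. 152: "it remains to prove that `τ` and `τ'` are equivalent"; the
tree's `jacquetLanglands_transfer_surjective_of_intertwiner'`) this is applied with the family of
groups `GL₂(K_v)`, `v ∉ S`, `σ` inside the cuspidal representation on the `GL(2)` side and `H₁` on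
the quaternion side, the Hilbert–Schmidt inequality being the trace identity (10.10).
[cite: JacquetLanglands1970, §16, Lemma 16.1.1; Gelbart1975, Lemma 10.6] -/
theorem exists_subspace_intertwiner_of_hilbertSchmidt_le
    (π₁ : ∀ v, ContRepresentation ℂ (G v) H₁) (π₂ : ∀ v, ContRepresentation ℂ (G v) H₂)
    (hπ₁ : ∀ v, (π₁ v).IsUnitary) (hπ₂ : ∀ v, (π₂ v).IsUnitary)
    (B : Submodule ℂ ((H₁ →L[ℂ] H₁) × (H₂ →L[ℂ] H₂)))
    (hmul : ∀ f ∈ B, ∀ h ∈ B, f * h ∈ B) (hstar : ∀ f ∈ B, star f ∈ B)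
    (hG : ∀ (v : 𝔳) (g : G v), ∀ f ∈ B,
      ((π₁ v g, π₂ v g) : (H₁ →L[ℂ] H₁) × (H₂ →L[ℂ] H₂)) * f ∈ B)
    {ι : Type*} (b : HilbertBasis ι ℂ H₁) {κ : Type*} (c : HilbertBasis κ ℂ H₂)
    (hHS : ∀ f ∈ B, ∑' j, (‖f.2 (c j)‖₊ : ℝ≥0∞) ^ 2 ≤ ∑' i, (‖f.1 (b i)‖₊ : ℝ≥0∞) ^ 2)
    (hfin : ∀ f ∈ B, ∑' i, (‖f.1 (b i)‖₊ : ℝ≥0∞) ^ 2 < ∞)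
    (σ : Submodule ℂ H₂) (hσc : IsClosed (σ : Set H₂))
    (hσG : ∀ (v : 𝔳) (g : G v), ∀ x ∈ σ, π₂ v g x ∈ σ) (hσB : ∀ f ∈ B, ∀ x ∈ σ, f.2 x ∈ σ)
    (hnd : ∃ f ∈ B, ∃ x ∈ σ, f.2 x ≠ 0) :
    ∃ T : σ →L[ℂ] H₁, T ≠ 0 ∧
      (∀ (v : 𝔳) (g : G v) (x : σ), T ⟨π₂ v g x, hσG v g x x.2⟩ = π₁ v g (T x)) ∧
      ∀ f (hf : f ∈ B) (x : σ), T ⟨f.2 x, hσB f hf x x.2⟩ = f.1 (T x) := by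
  obtain ⟨S, ⟨x, hx, hSx⟩, hSG, hSB⟩ := exists_intertwiner_adjoint_of_hilbertSchmidt_le π₁ π₂ hπ₁
    hπ₂ B hmul hstar hG b c hHS hfin σ hσc hσB hnd
  refine ⟨S ∘L σ.subtypeL, fun h0 => hSx ?_, fun v g w => ?_, fun f hf w => ?_⟩
  · have := DFunLike.congr_fun h0 ⟨x, hx⟩
    rwa [ContinuousLinearMap.comp_apply, Submodule.subtypeL_apply, zero_apply] at this
  · rw [ContinuousLinearMap.comp_apply, ContinuousLinearMap.comp_apply, Submodule.subtypeL_apply,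
      Submodule.subtypeL_apply, ← ContinuousLinearMap.comp_apply (f := π₂ v g), hSG v g,
      ContinuousLinearMap.comp_apply]
  · rw [ContinuousLinearMap.comp_apply, ContinuousLinearMap.comp_apply, Submodule.subtypeL_apply,
      Submodule.subtypeL_apply, ← ContinuousLinearMap.comp_apply (f := f.2), hSB f hf,
      ContinuousLinearMap.comp_apply]

end Comparison

end Literature.NumberTheory.Automorphic
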